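import Summits.BirchSwinnertonDyer.BirchSwinnertonDyer.Theorems.GenusKolyvaginAtTwoPowDvdShaCardAtTwoRTNonPhantomHres
import Summits.BirchSwinnertonDyer.BirchSwinnertonDyer.Theorems.GenusKolyvaginAtTwoEquivariantChebotarevAtTwoSigned
import Summits.BirchSwinnertonDyer.BirchSwinnertonDyer.Theorems.GenusKolyvaginAtTwoVisiblePairAtTwoKolyvaginClassSign
import Summits.BirchSwinnertonDyer.BirchSwinnertonDyer.Theorems.ByReductionTypeAtTwoRankOneAtTwoBigImageOddLocalOneDoorBottomLemma43AtTwo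
import Summits.BirchSwinnertonDyer.BirchSwinnertonDyer.Theorems.Rank1ResidualJetCompatibleData
import Summits.BirchSwinnertonDyer.BirchSwinnertonDyer.Theorems.GenusKolyvaginAtTwoPowDvdShaCardAtTwoRTFullOrderPairChebotarev
import Summits.BirchSwinnertonDyer.BirchSwinnertonDyer.Theorems.GenusKolyvaginAtTwoEquivariantKolyvaginExactAtTwoPairBookkeeping
import Summits.BirchSwinnertonDyer.BirchSwinnertonDyer.Theses.GenusKolyvaginAtTwo
import HarnessLib

/-!
# Route `GenusKolyvaginAtTwo`, crux L_T `PowDvdShaCardAtTwoRT` (stmt-BirchSwinnertonDyer-23242), LINE 18 stub KS `stub_kolyvaginSystemAtTwo`: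
# THE ANTITONE STEP OF KOLYVAGIN'S MINIMA AT 2 — `m_{r+1} ≤ m_r` — from signed Q5R, (NPh) and Q2

LEAD seat `bsd-line-gk2-p1` g17 (cell `bsd-f1-sign2`), `--supports 23242 --as helper`.  THEOREMS ONLY; no `sorry`; standard axioms.
BSD is NOT proved by any of this; neither is the crux, nor stub KS, nor stub L.

WHY (memo `Cruxes/PowDvdShaCardAtTwoRT/Lines/plus-descent-lead-g17.md` §5, KS assembly map).  The displayed hypothesis (KS) of gk2-p2's capstone
`PlusDescent.twinShaLadders_of_kolyvaginSuppliesAtTwo` (p707080) asks for Kolyvagin's depth minima `Mr` at `2`: antitone, `Mr 0 = M₀`, `Mr R = 0`,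
and McCallum's Prop. 5.2 at every drop.  With `Mr r := L − max{log₂ ord c_L(d) : d a datum at a square-free r-fold product of Zhang–Kolyvagin primes
of index ≥ L}` the antitonicity is McCallum §5 p. 285 («choose `l ∈ S(M_r+1)` prime to `n` so that `c_{M_r+1}(n)_λ ≠ 0`; then `p^{M_r} ∥ P_{nl}`
… hence `M_{r+1} ≤ M_r`»): ONE Čebotarev prime at which the class of a realising datum has FULL local order, a compatible datum at `nℓ` (Gross's CM
construction, `JET.exists_compatible_data_of_grossCM`), and Q2's order clause.  The Čebotarev is signed Q5R
(`GenusExact.equivariantChebotarevAtTwo_eigen_of_not_isSquare`, family of ONE eigenclass — sign by Gross 5.4 at 2,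
`KolyvaginClassSign.sign_conjAct_kolyvaginClass_two`), whose separation hypothesis `hres` is DISCHARGED from the displayed non-phantom hypothesis
**(NPh_L)** by `RelaxedCount.hres_of_nonPhantom_pow` (p708349), the class being Selmer off `n` (Gross 6.2(1) at 2 on the odd-Tamagawa slice,
`RankOneAtTwoOneDoor.kolyvaginClass_two_mem_selmerLocalKer_of_odd_tamagawaProduct`).
* **`exists_datum_mul_pow_zsmul_kolyvaginClass_ne_zero`** — on L's frame with (NPh_L) and Q2: for a datum `d` at `n` (square-free, Zhang–Kolyvagin
  primes of index `≥ L`) with `addOrderOf c_L(d) = 2^w`, `w ≥ 1`, there are a Zhang–Kolyvagin prime `ℓ ∤ n` of index `≥ L` and a datum `d′` at `nℓ`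
  with `2^{w−1}•c_L(d′) ≠ 0` (so `ord c_L(d′) ≥ 2^w`: the minimum does not increase with the depth).
Namespace `…Theorems.GenusExact.RelaxedCount`.  Closes nothing.  BSD is NOT proved by any of this.

References: [McCallumLMS1991] §5 p. 285 (definition of `M_r`, «hence `M_{r+1} ≤ M_r`»), §3 Cor. 3.2, §4 Prop. 4.4, Lemma 4.3;
[GrossLMS1991] §3 (3.3), Prop. 5.4, Prop. 6.2; [Kolyvagin1991StructureSha].
-/

set_option autoImplicit false
-- the Theorems namespace of this sub repeats the summit name by design (D-0017 nested layout)
set_option linter.dupNamespace false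

noncomputable section

open scoped Classical

open Field NumberField IsDedekindDomain WeierstrassCurve Rat.HeightOneSpectrum
open Literature.NumberTheory.EllipticCurves
open Literature.NumberTheory.GaloisRepresentations
open Summit.BirchSwinnertonDyer.BirchSwinnertonDyer.Theses.GenusKolyvaginAtTwo (KolyvaginRelationAtTwo)
open Summit.BirchSwinnertonDyer.Rank1Residual (X11b.KolyvaginAssembly.discr_lt_neg_four JET.exists_compatible_data_of_grossCM)
open Summit.BirchSwinnertonDyer.BirchSwinnertonDyer.Theorems.GenusExact.VisiblePairAtTwo
  (natCast_mem_primesEquiv_symm natCast_prime_mem_iff_eq exists_natCast_mem)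

namespace Summit.BirchSwinnertonDyer.BirchSwinnertonDyer.Theorems.GenusExact.RelaxedCount

variable (W : WeierstrassCurve ℚ) [W.IsElliptic] [W.IsGloballyMinimal] [NeZero (W.conductorNorm ℤ)]
  {K : Type} [Field K] [NumberField K]

omit [NumberField K] in
/-- **A square-free product of Kolyvagin primes avoids a place not over its prime factors.**  For `n` square-free and a finite place `w` of `K`
with `(q : 𝓞 K) ∉ w` for every prime `q ∣ n`: `(n : 𝓞 K) ∉ w`. [folklore] -/
theorem natCast_notMem_of_forall_primeFactors {n : ℕ} (hn : Squarefree n) (w : HeightOneSpectrum (𝓞 K))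
    (h : ∀ q ∈ n.primeFactors, (q : 𝓞 K) ∉ w.asIdeal) : (n : 𝓞 K) ∉ w.asIdeal := by
  intro hmem
  rw [← Nat.prod_primeFactors_of_squarefree hn, Nat.cast_prod] at hmem
  haveI := w.isPrime
  obtain ⟨q, hq, hqw⟩ := Ideal.IsPrime.prod_mem_iff.mp hmem
  exact h q hq hqw

/-- **The antitone step of Kolyvagin's minima at `2` (`M_{r+1} ≤ M_r`).**  Frame of L_T: `E/ℚ` globally minimal, non-CM, `Δ < 0`, odd Tamagawa
product, `ρ_{E,2^∞}` onto; `K` imaginary quadratic with `d_K` odd `≠ −3`, the Heegner hypothesis, `d_K·(−|Δ|)` not a square; `c ≠ 1` in `Gal(K/ℚ)`;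
Q2 (`KolyvaginRelationAtTwo`) granted; (NPh_L): no non-zero class of `H¹(K, E[2^L])` dying on `Γ_{K(E[2^L])}` is Selmer at every finite place.
Let `d` be a Kolyvagin–Heegner datum at a square-free product `n` of Zhang–Kolyvagin primes of index `≥ L` with `addOrderOf c_L(d) = 2^w`, `w ≥ 1`.
THEN there are a Zhang–Kolyvagin prime `ℓ ∤ n` of index `≥ L` with `Frob_ℓ = Frob_∞` on `K(E[2^L])` and a datum `d′` at `nℓ` (square-free, all prime
factors Zhang–Kolyvagin of index `≥ L`) with `2^{w−1}•c_L(d′) ≠ 0`.  Proof: `c_L(d)` is a `c`-eigenclass (Gross 5.4 at 2) and Selmer off `n` (Gross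
6.2(1) at 2, odd Tamagawa), so (NPh_L) gives Q5R's `hres`; signed Q5R gives infinitely many `ℓ` with `ord loc_λ c_L(d) = 2^w`; a compatible datum
`d′` at `nℓ` exists (Gross's CM construction); Q2 transports `2^{w−1} c_L(d) ∉ tors_λ` to `2^{w−1} c_L(d′) ∉ tors_λ`.
[cite: McCallumLMS1991, §5 p. 285; §3 Cor. 3.2; §4 Prop. 4.4] [cite: GrossLMS1991, Prop. 5.4, Prop. 6.2] -/
theorem exists_datum_mul_pow_zsmul_kolyvaginClass_ne_zero (hQ2 : KolyvaginRelationAtTwo)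
    (hcm : ¬ W.HasCM) (hΔ : W.Δ < 0) (hT : Odd W.tamagawaProduct)
    (hρ : ∀ m : ℕ, W.HasSurjectiveModNGaloisRep (2 ^ m : ℕ))
    (hK : IsImaginaryQuadratic K) (hodd : Odd (NumberField.discr K)) (h3 : NumberField.discr K ≠ -3)
    (hHe : SatisfiesHeegnerHypothesis (W.conductorNorm ℤ) K) (hns : ¬ IsSquare ((NumberField.discr K : ℚ) * -|W.Δ|))
    (c : K ≃ₐ[ℚ] K) (hc : c ≠ 1)
    (Dt : ModularForms.ModularParametrizationData W (W.conductorNorm ℤ)) (β : ℤ) (ι : K →+* ℂ)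
    {L : ℕ} (hL : 1 ≤ L)
    (hNPh : ∀ z : galH1Torsion (W.baseChange K) ((2 ^ L : ℕ) : ℤ),
      (∀ ρ' ∈ torsionFixing (W.baseChange K) ((2 ^ L : ℕ) : ℤ), h1Eval (W.baseChange K) ((2 ^ L : ℕ) : ℤ) z ρ' = 0) →
      (∀ w : HeightOneSpectrum (𝓞 K), z ∈ selmerLocalKer (W.baseChange K) (w.adicCompletion K) ((2 ^ L : ℕ) : ℤ)) → z = 0)
    {n : ℕ} (hn : Squarefree n)
    (hnK : ∀ q ∈ n.primeFactors, Zhang2014.IsKolyvaginPrime (W.conductorNorm ℤ) W K 2 q ∧ L ≤ Zhang2014.kolyvaginIndex W 2 q)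
    (d : KolyvaginHeegnerData Dt β ι n) {w : ℕ} (hw : 1 ≤ w)
    (hord : addOrderOf (d.kolyvaginClass Nat.prime_two L) = 2 ^ w) :
    ∃ (ℓ : ℕ) (d' : KolyvaginHeegnerData Dt β ι (n * ℓ)), ℓ.Prime ∧ ℓ ∉ n.primeFactors ∧
      Zhang2014.IsKolyvaginPrime (W.conductorNorm ℤ) W K 2 ℓ ∧ L ≤ Zhang2014.kolyvaginIndex W 2 ℓ ∧ FrobEqFrobInfty W K (2 ^ L) ℓ ∧
      Squarefree (n * ℓ) ∧
      (∀ q ∈ (n * ℓ).primeFactors, Zhang2014.IsKolyvaginPrime (W.conductorNorm ℤ) W K 2 q ∧ L ≤ Zhang2014.kolyvaginIndex W 2 q) ∧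
      ((2 ^ (w - 1) : ℕ) : ℤ) • d'.kolyvaginClass Nat.prime_two L ≠ 0 := by
  have hn0 : n ≠ 0 := hn.ne_zero
  have h4 : NumberField.discr K ≠ -4 := fun h ↦ by
    rw [h] at hodd
    exact (Int.not_even_iff_odd.mpr hodd) ⟨-2, by norm_num⟩
  have hD : NumberField.discr K < -4 := X11b.KolyvaginAssembly.discr_lt_neg_four hK ⟨h3, h4⟩
  have hsurj1 : W.HasSurjectiveModNGaloisRep ((2 : ℤ) ^ 1) := by exact_mod_cast hρ 1
  set cls := d.kolyvaginClass Nat.prime_two L with hcls_def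
  have hcls0 : cls ≠ 0 := PlusDescent.ne_zero_of_addOrderOf_eq_two_pow hw hord
  -- the sign of the class (Gross 5.4 at 2)
  obtain ⟨hsgn, hτ⟩ := KolyvaginClassSign.sign_conjAct_kolyvaginClass_two hK h3 h4 hodd hHe hsurj1 c hc Dt β ι hn hL hnK d
  -- Selmer off `n` (Gross 6.2(1) at 2, odd Tamagawa)
  have hsel : ∀ w' : HeightOneSpectrum (𝓞 K), (n : 𝓞 K) ∉ w'.asIdeal →
      cls ∈ selmerLocalKer (W.baseChange K) (w'.adicCompletion K) ((2 ^ L : ℕ) : ℤ) := fun w' hw' ↦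
    RankOneAtTwoOneDoor.kolyvaginClass_two_mem_selmerLocalKer_of_odd_tamagawaProduct W hρ hT K hK h3 h4 hHe Dt β ι L hn hnK d w' hw'
  -- the places of `ℚ` under the prime factors of `n`
  set T : Finset (Place ℚ) :=
    n.primeFactors.attach.image (fun q ↦ (Sum.inr (primesEquiv.symm ⟨q.1, Nat.prime_of_mem_primeFactors q.2⟩) : Place ℚ)) with hT_def
  have hTdata : ∀ u ∈ T, ∃ (v : HeightOneSpectrum (𝓞 ℚ)) (q : ℕ), u = Sum.inr v ∧ q.Prime ∧ (q : 𝓞 ℚ) ∈ v.asIdeal ∧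
      Zhang2014.IsKolyvaginPrime (W.conductorNorm ℤ) W K 2 q ∧ L ≤ Zhang2014.kolyvaginIndex W 2 q := by
    intro u hu
    rw [hT_def, Finset.mem_image] at hu
    obtain ⟨q, -, rfl⟩ := hu
    exact ⟨_, q.1, rfl, Nat.prime_of_mem_primeFactors q.2, natCast_mem_primesEquiv_symm _, (hnK q.1 q.2).1, (hnK q.1 q.2).2⟩
  -- a place of `K` not over `T` does not divide `n`
  have hoff : ∀ w' : HeightOneSpectrum (𝓞 K), (Sum.inr (w'.under (𝓞 ℚ)) : Place ℚ) ∉ T → (n : 𝓞 K) ∉ w'.asIdeal := by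
    intro w' hw'
    refine natCast_notMem_of_forall_primeFactors (K := K) hn w' fun q hq hqw ↦ hw' ?_
    have hqp : q.Prime := Nat.prime_of_mem_primeFactors hq
    have hunder : (q : 𝓞 ℚ) ∈ (w'.under (𝓞 ℚ)).asIdeal := by
      change (q : 𝓞 ℚ) ∈ w'.asIdeal.under (𝓞 ℚ)
      rw [Ideal.under_def, Ideal.mem_comap, map_natCast]
      exact hqw
    have heq : w'.under (𝓞 ℚ) = primesEquiv.symm ⟨q, hqp⟩ := (natCast_prime_mem_iff_eq hqp _).mp hunder
    rw [hT_def, Finset.mem_image]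
    exact ⟨⟨q, hq⟩, Finset.mem_attach _ _, by rw [heq]⟩
  -- Q5R's separation hypothesis from (NPh_L)
  have hres : ∀ a : Fin 1 → ℤ, (∀ ρ' ∈ torsionFixing (W.baseChange K) ((2 ^ L : ℕ) : ℤ),
      h1Eval (W.baseChange K) ((2 ^ L : ℕ) : ℤ) (∑ i, a i • (![cls] : Fin 1 → _) i) ρ' = 0) → ∑ i, a i • (![cls] : Fin 1 → _) i = 0 :=
    hres_of_nonPhantom_pow W hK T hTdata hNPh ![cls] fun i w' hw' ↦ by
      fin_cases i
      exact hsel w' (hoff w' hw')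
  -- signed Q5R for the single eigenclass `cls`, full local order `2^w`
  have hinf := equivariantChebotarevAtTwo_eigen_of_not_isSquare (W.conductorNorm ℤ) W hcm hΔ K hK hns hρ c hc L hL 1 ![cls]
    ![-W.rootNumber * (-1) ^ n.primeFactors.card]
    (fun i ↦ by fin_cases i; exact hsgn) (fun i ↦ by fin_cases i; exact hcls0) (fun i ↦ by fin_cases i; exact hτ)
    (fun a ha i ↦ by
      fin_cases i
      simp only [Fin.sum_univ_one, Fin.isValue, Matrix.cons_val_zero] at ha
      show ((addOrderOf cls : ℕ) : ℤ) ∣ a 0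
      rw [addOrderOf_dvd_iff_zsmul_eq_zero]
      exact ha)
    hres ![w] (fun i ↦ by fin_cases i; exact hord) ![w] (fun i ↦ by fin_cases i; exact le_rfl)
  -- a new prime `ℓ ∤ n`
  obtain ⟨ℓ, hℓmem, hℓn⟩ := hinf.exists_notMem_finset n.primeFactors
  obtain ⟨hFrob, hKol, hidx, hloc⟩ := hℓmem
  have hℓp : ℓ.Prime := hKol.1
  have hℓdvd : ¬ ℓ ∣ n := fun h ↦ hℓn (Nat.mem_primeFactors.mpr ⟨hℓp, h, hn0⟩)
  have hsq : Squarefree (n * ℓ) :=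
    (Nat.squarefree_mul ((Nat.Prime.coprime_iff_not_dvd hℓp).mpr hℓdvd).symm).mpr ⟨hn, hℓp.squarefree⟩
  have hall : ∀ q ∈ (n * ℓ).primeFactors, Zhang2014.IsKolyvaginPrime (W.conductorNorm ℤ) W K 2 q ∧
      L ≤ Zhang2014.kolyvaginIndex W 2 q := by
    intro q hq
    rw [Nat.primeFactors_mul hn0 hℓp.ne_zero, Finset.mem_union] at hq
    rcases hq with hq | hq
    · exact hnK q hq
    · rw [hℓp.primeFactors, Finset.mem_singleton] at hq
      subst hq
      exact ⟨hKol, hidx⟩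
  -- a compatible datum at `nℓ` (Gross's CM construction)
  obtain ⟨dℓ, hdℓ⟩ := JET.exists_compatible_data_of_grossCM
    (phi_heegnerPointOfConductor_mem_range_map_ringClassField_holds (W.conductorNorm ℤ) W K) hK hD hHe 2 Dt β ι hn
    (fun q hq ↦ (hnK q hq).1) d
  obtain ⟨hσ, hS, hS', hemb⟩ := hdℓ ℓ hKol hℓn
  set d' := dℓ ℓ hKol hℓn with hd'_def
  -- the place `λ ∋ ℓ` of `K` and the local orders there
  obtain ⟨v, hv⟩ := exists_natCast_mem (K := K) hℓp
  have hlocv : ∀ j : ℕ, ((2 ^ j : ℕ) : ℤ) • cls ∈ (W.baseChange K).torsionLocalKer (v.adicCompletion K) ((2 ^ L : ℕ) : ℤ) ↔ w ≤ j :=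
    fun j ↦ by simpa using hloc 0 v hv j
  -- Q2 at `λ`: the order of `c_L(d′)` at `λ` is the order of `c_L(d)` at `λ`
  have hQ := hQ2 W hcm K hK h3 h4 hHe hρ Dt β ι L hL n ℓ hsq hℓp hℓdvd hall d d' hσ hS hS' hemb v hv (w - 1)
  refine ⟨ℓ, d', hℓp, hℓn, hKol, hidx, hFrob, hsq, hall, fun h0 ↦ ?_⟩
  have hmem : ((2 ^ (w - 1) : ℕ) : ℤ) • d'.kolyvaginClass Nat.prime_two L ∈
      (W.baseChange K).torsionLocalKer (v.adicCompletion K) ((2 ^ L : ℕ) : ℤ) := by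
    rw [h0]; exact AddSubgroup.zero_mem _
  have := (hlocv (w - 1)).mp (hQ.2.mp hmem)
  omega

end Summit.BirchSwinnertonDyer.BirchSwinnertonDyer.Theorems.GenusExact.RelaxedCount

end
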